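import Mathlib
import HarnessLib
import Summits.HubbardSuperconductivity.HubbardSuperconductivity.Theorems.KLProgrammePolarRayCoareaFrame

/-!
# Route `KLProgramme` — crux K3 split, ENGINE child (`KLRegimeEngineV11` stmt-HubbardSuperconductivity-19823): SIZE AND e-LIPSCHITZ CONSTANT OF
# THE LEVEL-SET JACOBIAN `𝒥_E(θ,e) = u_E(μ+e,θ)·(∂_tG(θ,u_E(μ+e,θ)))⁻¹` of the frame's curve — the `B_W`, `L_W` inputs of the zero-sound /
# thermal estimate `klte_slice_bubble_weighted_norm_le` (cell gate-hubbard-kl, seat hubbard-kl-k3c2-p2 «thermal-bar induction n ≤ nScales β + 1»)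

`…PolarRayCoareaFrame` writes the carrier's `∫ d²k` as `∫ dθ ∫ de 𝒥_E(θ,e) • h`; the `(k₀,e)`-plane estimates take the insertion `W(e) = [local factor]·𝒥_E(θ,e)`
with `‖W‖ ≤ B_W` and `‖W(e) − W(0)‖ ≤ L_W|e|`.  This module supplies, under p4's hypotheses (`B : BandBounds a b`, `δ ∈ C¹`, `|δ| ≤ κ₀`, `‖Dδ‖ ≤ κ₁ < Dt_min`)
and a margin window:
* `klrj_rayDispersionDt_lipschitz`: `|∂_tε₀(θ,s) − ∂_tε₀(θ,t)| ≤ 2|s − t|` (elementary: `sin` is 1-Lipschitz, `cos²θ + sin²θ = 1`);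
* `klrj_jacobian_nonneg`, `klrj_jacobian_le`: `0 ≤ 𝒥_E(θ,e) ≤ π√2/(Dt_min − κ₁)` (`u_E < π/‖dir θ‖_∞ ≤ π√2`, `∂_tG ≥ Dt_min − κ₁`);
* `klrj_jacobian_lipschitz`: with a RADIAL Lipschitz bound `κ₂` for the directional derivative `t ↦ Dδ(t·dir θ)[dir θ]` on the ray segment (from `‖D²δ‖ ≤ κ₂`,
  p4's `norm_iteratedFDeriv_frameShift_le_of_frameOK` for the frame), for `e, e' ∈ [−ē, ē]`:
  `|𝒥_E(θ,e) − 𝒥_E(θ,e')| ≤ (1/d² + π√2·(2 + κ₂)/d³)·|e − e'|`, `d = Dt_min − κ₁` — derivative-free (level-Lipschitz of `u_E`, `klrf_level_lipschitz`).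
So `B_W = |c|·π√2/d`, `L_W = |c|·(1/d² + π√2(2+κ₂)/d³)` for `W = c·𝒥_E(θ,·)`.  Pure analysis on the tree's objects.
References: BGM 2006 §2.4 Lemma 2.1 (2.40)–(2.41), §2.5 (2.56b); HOME/hubbard-kl-k3c2-p2/ZS-RECIPE.md §2–§3.
-/

noncomputable section

namespace Summit.HubbardSuperconductivity.HubbardSuperconductivity.Theorems.KLRegimeSplit

set_option linter.dupNamespace false -- summit = problem name (single-conjunct summit), D-0017

open Real Set Filter Literature.MathematicalPhysics.QuantumLattice
open Literature.MathematicalPhysics.QuantumLattice.BandSectorCounting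
open Summit.HubbardSuperconductivity.HubbardSuperconductivity.Theorems.PerturbedFermiCurve

/-- **`∂_tε₀(θ,·)` is 2-Lipschitz**: `|∂_tε₀(θ,s) − ∂_tε₀(θ,t)| ≤ 2|s − t|`. -/
theorem klrj_rayDispersionDt_lipschitz (θ s t : ℝ) : |rayDispersionDt θ s - rayDispersionDt θ t| ≤ 2 * |s - t| := by
  unfold rayDispersionDt
  have hc := Real.abs_cos_le_one θ
  have hs := Real.abs_sin_le_one θ
  have h1 : |Real.sin (s * Real.cos θ) - Real.sin (t * Real.cos θ)| ≤ |Real.cos θ| * |s - t| := by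
    refine (Real.abs_sin_sub_sin_le _ _).trans (le_of_eq ?_)
    rw [← sub_mul, abs_mul, mul_comm]
  have h2 : |Real.sin (s * Real.sin θ) - Real.sin (t * Real.sin θ)| ≤ |Real.sin θ| * |s - t| := by
    refine (Real.abs_sin_sub_sin_le _ _).trans (le_of_eq ?_)
    rw [← sub_mul, abs_mul, mul_comm]
  have hsq : Real.cos θ ^ 2 + Real.sin θ ^ 2 = 1 := by rw [add_comm]; exact Real.sin_sq_add_cos_sq θ
  have hst : 0 ≤ |s - t| := abs_nonneg _
  calc |2 * (Real.cos θ * Real.sin (s * Real.cos θ) + Real.sin θ * Real.sin (s * Real.sin θ)) -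
        2 * (Real.cos θ * Real.sin (t * Real.cos θ) + Real.sin θ * Real.sin (t * Real.sin θ))|
      = 2 * |Real.cos θ * (Real.sin (s * Real.cos θ) - Real.sin (t * Real.cos θ)) +
          Real.sin θ * (Real.sin (s * Real.sin θ) - Real.sin (t * Real.sin θ))| := by
        rw [← mul_sub, abs_mul, abs_two]; ring_nf
    _ ≤ 2 * (|Real.cos θ| * (|Real.cos θ| * |s - t|) + |Real.sin θ| * (|Real.sin θ| * |s - t|)) := by
        refine mul_le_mul_of_nonneg_left ((abs_add_le _ _).trans ?_) (by norm_num)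
        rw [abs_mul, abs_mul]
        exact add_le_add (mul_le_mul_of_nonneg_left h1 (abs_nonneg _)) (mul_le_mul_of_nonneg_left h2 (abs_nonneg _))
    _ = 2 * (Real.cos θ ^ 2 + Real.sin θ ^ 2) * |s - t| := by rw [← sq_abs (Real.cos θ), ← sq_abs (Real.sin θ)]; ring
    _ = 2 * |s - t| := by rw [hsq, mul_one]

/-- `π/‖dir θ‖_∞ ≤ π√2` (the exit parameter of a ray is at most the half-diagonal). -/
theorem klrj_exit_le (θ : ℝ) : π / ‖dir θ‖ ≤ π * Real.sqrt 2 := by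
  have h := sqrt_two_div_two_le_norm_dir θ
  have hn := norm_dir_pos θ
  have h2 : 0 < Real.sqrt 2 := Real.sqrt_pos.mpr (by norm_num)
  rw [div_le_iff₀ hn]
  have hss : Real.sqrt 2 * Real.sqrt 2 = 2 := Real.mul_self_sqrt (by norm_num)
  nlinarith [Real.pi_pos, mul_le_mul_of_nonneg_left h (le_of_lt (mul_pos Real.pi_pos h2))]

section Frame

variable {a b : ℝ} (B : BandBounds a b) {δ : (Fin 2 → ℝ) → ℝ} (hδ1 : ContDiff ℝ 1 δ) {κ₀ κ₁ : ℝ}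
  (hδ : ∀ k : Fin 2 → ℝ, (∀ i, |k i| ≤ π) → |δ k| ≤ κ₀)
  (hκ : ∀ k : Fin 2 → ℝ, (∀ i, |k i| ≤ π) → ‖fderiv ℝ δ k‖ ≤ κ₁) (hκ₁ : κ₁ < B.Dtmin)

include B hδ hκ hκ₁ in
/-- **The Jacobian is nonnegative** at an admissible level. -/
theorem klrj_jacobian_nonneg (hδc : Continuous δ) {ν : ℝ} (hν : a ≤ ν - κ₀) (hν' : ν + κ₀ ≤ b) (θ : ℝ) :
    0 ≤ perturbedFermiRadius δ ν θ *
      (rayDispersionDt θ (perturbedFermiRadius δ ν θ) + fderiv ℝ δ (perturbedFermiRadius δ ν θ • dir θ) (dir θ))⁻¹ := by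
  have hD := klrf_pertDt_ge B hδ hκ hδc hν hν' θ
  have hd : 0 < B.Dtmin - κ₁ := by linarith
  have hu := (perturbedFermiRadius_mem_Ioo B hδc hδ hν hν' θ).1
  exact mul_nonneg hu.le (inv_nonneg.mpr (by linarith))

include B hδ hκ hκ₁ in
/-- **Size of the Jacobian**: `𝒥_E(θ,ν) ≤ π√2/(Dt_min − κ₁)` at an admissible level. -/
theorem klrj_jacobian_le (hδc : Continuous δ) {ν : ℝ} (hν : a ≤ ν - κ₀) (hν' : ν + κ₀ ≤ b) (θ : ℝ) :
    perturbedFermiRadius δ ν θ *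
        (rayDispersionDt θ (perturbedFermiRadius δ ν θ) + fderiv ℝ δ (perturbedFermiRadius δ ν θ • dir θ) (dir θ))⁻¹ ≤
      Real.pi * Real.sqrt 2 / (B.Dtmin - κ₁) := by
  have hD := klrf_pertDt_ge B hδ hκ hδc hν hν' θ
  have hd : 0 < B.Dtmin - κ₁ := by linarith
  have hu := perturbedFermiRadius_mem_Ioo B hδc hδ hν hν' θ
  have hup : perturbedFermiRadius δ ν θ ≤ Real.pi * Real.sqrt 2 := hu.2.le.trans (klrj_exit_le θ)
  rw [← div_eq_mul_inv]
  exact div_le_div₀ (by positivity) hup hd hD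

include B hδ1 hδ hκ hκ₁ in
/-- **The Jacobian is Lipschitz in the level**: with a radial Lipschitz bound `κ₂` for `t ↦ Dδ(t·dir θ)[dir θ]` on the ray segment, for admissible levels
`ν, ν'` (`a ≤ · − κ₀`, `· + κ₀ ≤ b`):
`|𝒥_E(θ,ν) − 𝒥_E(θ,ν')| ≤ (1/d² + π√2·(2 + κ₂)/d³)·|ν − ν'|`, `d = Dt_min − κ₁`. -/
theorem klrj_jacobian_lipschitz {κ₂ : ℝ} (hκ₂ : 0 ≤ κ₂) {θ : ℝ}
    (hD2 : ∀ s t : ℝ, s ∈ Icc 0 (π / ‖dir θ‖) → t ∈ Icc 0 (π / ‖dir θ‖) →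
      |fderiv ℝ δ (s • dir θ) (dir θ) - fderiv ℝ δ (t • dir θ) (dir θ)| ≤ κ₂ * |s - t|)
    {ν ν' : ℝ} (hν : a ≤ ν - κ₀) (hνb : ν + κ₀ ≤ b) (hν'a : a ≤ ν' - κ₀) (hν' : ν' + κ₀ ≤ b) :
    |perturbedFermiRadius δ ν θ *
          (rayDispersionDt θ (perturbedFermiRadius δ ν θ) + fderiv ℝ δ (perturbedFermiRadius δ ν θ • dir θ) (dir θ))⁻¹ -
        perturbedFermiRadius δ ν' θ *
          (rayDispersionDt θ (perturbedFermiRadius δ ν' θ) + fderiv ℝ δ (perturbedFermiRadius δ ν' θ • dir θ) (dir θ))⁻¹| ≤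
      (1 / (B.Dtmin - κ₁) ^ 2 + Real.pi * Real.sqrt 2 * (2 + κ₂) / (B.Dtmin - κ₁) ^ 3) * |ν - ν'| := by
  have hδc : Continuous δ := hδ1.continuous
  set d := B.Dtmin - κ₁ with hd_def
  have hd : 0 < d := by rw [hd_def]; linarith
  set u := perturbedFermiRadius δ ν θ with hu_def
  set u' := perturbedFermiRadius δ ν' θ with hu'_def
  set D := rayDispersionDt θ u + fderiv ℝ δ (u • dir θ) (dir θ) with hD_def
  set D' := rayDispersionDt θ u' + fderiv ℝ δ (u' • dir θ) (dir θ) with hD'_def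
  have hDge : d ≤ D := klrf_pertDt_ge B hδ hκ hδc hν hνb θ
  have hD'ge : d ≤ D' := klrf_pertDt_ge B hδ hκ hδc hν'a hν' θ
  have hDpos : 0 < D := hd.trans_le hDge
  have hD'pos : 0 < D' := hd.trans_le hD'ge
  have huI := perturbedFermiRadius_mem_Ioo B hδc hδ hν hνb θ
  have hu'I := perturbedFermiRadius_mem_Ioo B hδc hδ hν'a hν' θ
  have hu0 : 0 ≤ u := huI.1.le
  have hu'0 : 0 ≤ u' := hu'I.1.le
  have hu'le : u' ≤ Real.pi * Real.sqrt 2 := hu'I.2.le.trans (klrj_exit_le θ)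
  -- level-Lipschitz of `u`
  have hL : |u - u'| ≤ |ν - ν'| / d := klrf_level_lipschitz B hδ1 hδ hκ hκ₁ hν'a hν' hν hνb θ
  -- Lipschitz of `D` in `t` on the segment: `2 + κ₂`
  have hDD : |D - D'| ≤ (2 + κ₂) * |u - u'| := by
    have h1 := klrj_rayDispersionDt_lipschitz θ u u'
    have h2 := hD2 u u' ⟨hu0, huI.2.le⟩ ⟨hu'0, hu'I.2.le⟩
    calc |D - D'| = |(rayDispersionDt θ u - rayDispersionDt θ u') +
          (fderiv ℝ δ (u • dir θ) (dir θ) - fderiv ℝ δ (u' • dir θ) (dir θ))| := by rw [hD_def, hD'_def]; ring_nf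
      _ ≤ 2 * |u - u'| + κ₂ * |u - u'| := (abs_add_le _ _).trans (add_le_add h1 h2)
      _ = (2 + κ₂) * |u - u'| := by ring
  -- split `u/D − u'/D' = (u − u')/D + u'(1/D − 1/D')`
  have hsplit : u * D⁻¹ - u' * D'⁻¹ = (u - u') * D⁻¹ + u' * (D' - D) * (D⁻¹ * D'⁻¹) := by
    field_simp; ring
  rw [hsplit]
  have hA : |(u - u') * D⁻¹| ≤ |ν - ν'| / d * (1 / d) := by
    rw [abs_mul, abs_inv, abs_of_pos hDpos]
    exact mul_le_mul hL (by rw [one_div]; exact inv_anti₀ hd hDge) (inv_nonneg.mpr hDpos.le) (by positivity)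
  have hB : |u' * (D' - D) * (D⁻¹ * D'⁻¹)| ≤ Real.pi * Real.sqrt 2 * ((2 + κ₂) * (|ν - ν'| / d)) * (1 / d * (1 / d)) := by
    rw [abs_mul, abs_mul, abs_mul, abs_inv, abs_inv, abs_of_pos hDpos, abs_of_pos hD'pos, abs_of_nonneg hu'0, abs_sub_comm]
    have h1 : |D - D'| ≤ (2 + κ₂) * (|ν - ν'| / d) := hDD.trans (mul_le_mul_of_nonneg_left hL (by linarith))
    have h2 : D⁻¹ * D'⁻¹ ≤ 1 / d * (1 / d) := by
      rw [one_div]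
      exact mul_le_mul (inv_anti₀ hd hDge) (inv_anti₀ hd hD'ge) (inv_nonneg.mpr hD'pos.le) (inv_nonneg.mpr hd.le)
    exact mul_le_mul (mul_le_mul hu'le h1 (abs_nonneg _) (by positivity)) h2 (by positivity) (by positivity)
  calc |(u - u') * D⁻¹ + u' * (D' - D) * (D⁻¹ * D'⁻¹)| ≤ |(u - u') * D⁻¹| + |u' * (D' - D) * (D⁻¹ * D'⁻¹)| := abs_add_le _ _
    _ ≤ |ν - ν'| / d * (1 / d) + Real.pi * Real.sqrt 2 * ((2 + κ₂) * (|ν - ν'| / d)) * (1 / d * (1 / d)) := add_le_add hA hB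
    _ = (1 / d ^ 2 + Real.pi * Real.sqrt 2 * (2 + κ₂) / d ^ 3) * |ν - ν'| := by field_simp

end Frame

end Summit.HubbardSuperconductivity.HubbardSuperconductivity.Theorems.KLRegimeSplit

end
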